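import Summits.Ventures.CertifiedQuantumChemistry.Rows.SingletUpperSpinBound
import Summits.Ventures.CertifiedQuantumChemistry.Rows.DeterminantEnergyTables
import HarnessLib

/-!
# Ventures/CertifiedQuantumChemistry — Rows/TriangleLowerBound.lean: the coefficient (ℓ¹, "triangle") LOWER bound
# `B_△(F) = E_core − Σ_t |c_t| ≤ E₀(H_F; a, b)` PROVED for every model — the admissible `B` of FORMAT-qcmps0 §4b as a
# `LowerCertificate` / `LowerRow`, the singlet END form with the certificate's own `B_△`, kernel sanity handles for
# upper claim nodes, and a one-pass kernel evaluation on `Model.ofTables` literals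

HONEST FRAMING (verbatim): certified bounds for a stated model Hamiltonian in a stated basis; not a
claim about the real molecule beyond that model.

var-2 (gen 13), zero compute, PROVED glue only (0 sorry, no definition, no claim node, no row instantiated here).
The model Hamiltonian is the constant `E_core` plus a finite list of TERMS `c_t · w_t` — one-body words
`a†_{pσ} a_{qσ}` with `c_t = h_pq` and two-body words `a†_{pσ} a†_{rτ} a_{sτ} a_{qσ}` with `c_t = (pq|rs)/2`, over ALL
index tuples (`2k² + 4k⁴` terms; FORMAT-qcmps0 §3 `terms_from_integrals`, FORMAT-qcu0 §1). Every word is a product of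
creation / annihilation matrices, hence a contraction, so `⟨ψ, (H_F − E_core)ψ⟩ ≥ −(Σ_t |c_t|)·⟨ψ,ψ⟩` on every vector:

  `B_△(F) := E_core − Σ_t |c_t| = E_core − 2·Σ_{pq} |h_pq| − 2·Σ_{pqrs} |(pq|rs)| ≤ E₀(H_F; a, b)`   (every sector).

This is the crude constant `B_triangle` that var-2's `qc-upper-v0` MPS certificates print in their `value_singlet`
block (FORMAT-qcmps0 §4b: "B OF RECORD = B_triangle = E_core − Σ_t |c_t| … crude but free and independent of every
other certificate"; −110 E_h for H₆, −505 E_h for N₂/STO-6G). Up to the constant it is minus the ℓ¹ norm `λ` of the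
second-quantized coefficient list (the un-factorised "1-norm" of quantum-simulation cost models). In the tree so far
the singlet soundness theorem `singletUpperRow_of_spinCertificate` (`Rows/SingletUpperSpinBound.lean`) needed its
`B` supplied by a SEPARATE certified `LowerRow` — i.e. by another claim node. This file proves `B_△` admissible in the
kernel, for every model and every sector, in the cell's own certificate vocabulary:

* §Terms — `Model.hamiltonian_sub_ecore_eq`: `H_F − E_core·1 = Σ_t c_t • ladderWord w_t` (the raw term list
  as LADDER WORDS of `Literature/…/LadderWordCharge`, both families written as closed `Fin`-tuple sums);
  `Model.sum_norm_coeff_eq`: `Σ_t ‖c_t‖ = 2 Σ|h_pq| + 2 Σ|(pq|rs)|`.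
* §Certificate — **`Model.lowerCertificate_triangle`**: for EVERY `F : Model k`, every `(a, b)` and every rational
  `lo ≤ B_△(F)`, `LowerCertificate F a b lo` holds — the typer's predicate of `Rows/SectorRows.lean` with EMPTY Gram
  part, no multipliers, no charged / anti-Hermitian parts, `c = E_core`, and the whole term list as the "residual
  ladder words" whose cost is `Σ‖a_k‖` (each word a contraction: the soundness mechanism of `lowerRow_of_certificate`).
  Hence **`Model.lowerRow_triangle`** (`F.IsSymmetric`, `a, b ≤ k` ⇒ `LowerRow F a b lo`), `Model.singletLowerRow_triangle`,
  `Model.triangle_le_energy`.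
* §Sanity — every UPPER row / upper claim node of a symmetric model lies above `B_△`: `Model.triangle_le_of_upperRow`,
  `Model.not_upperRow_of_lt_triangle`, `Model.not_upperCertificate_of_lt_triangle` (a kernel FALSIFICATION HANDLE: an
  `UpperCertificate` literal below `B_△` is refutable by evaluation; nothing of the kind is asserted about any file).
* §Singlet — **`singletUpperRow_of_spinCertificate_triangle`**: a §4b spin-contaminated singlet certificate
  `SingletUpperCertificateSpin F n B hi` whose printed `B` is at most `B_△(F)` proves `SingletUpperRow F n hi` with NO
  second claim node (`B ≤ B_△` is a decidable statement about rationals).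
* §Tables — for literal models `Model.ofTables k hT eT ecore` (`Hamiltonians/`), ONE kernel pass over each table
  bounds the two coefficient sums: `Σ_{pq} |h_pq| ≤ Σ_{e ∈ hT} m₂(key e)·|val e|`, `Σ_{pqrs} |(pq|rs)| ≤ Σ_{e ∈ eT}
  m₄(key e)·|val e|` with the orbit multiplicities `m₂(a,b) = [a = b ? 1 : 2]`, `m₄(P₁,P₂) = [P₁ = P₂ ? 1 : 2]·m₂(P₁)·m₂(P₂)`
  (`card_filter_pairKey_le`, `card_filter_quadKey_le`: at most that many index tuples share a canonical key; NO
  hypothesis on the table — duplicate-free, canonical, in-range tables such as the tree's make the bound an equality,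
  which is not needed); entry point **`Model.lowerRow_ofTables_triangle`** whose only numeric hypothesis
  `lo ≤ ecore − 2·fold(hT) − 2·fold(eT)` (var-1's accumulator `Model.sumAcc` of `Rows/DeterminantEnergyTables.lean`)
  closes by `decide +kernel` — the LOWER companion of var-1's kernel-proved determinant UPPER rows
  (`Rows/DeterminantEnergy.lean`): together, brackets with no claim node on either side (hundreds of E_h wide — their
  point is the certificate class, not the width). On the tree's tables the fold IS the exact `B_triangle` rational that
  `qcmps` prints (e.g. `−214558829027960397/1953125000000000` for `h6Sto6gR1786`; instances are `Certificates/` business).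

What is NOT claimed: `B_△` is not a useful bound (it ignores all cancellation: |B_△| ~ 10²–10³ E_h against E₀ ~ 1–10²);
no row is instantiated in this file (instances belong in `Certificates/`); nothing is evaluated in floating point;
no statement about any certificate file of record. References: FORMAT-qcmps0 §4b (HOME `pub-qchem-var2/`), FORMAT-qcl1
§7 (residual words are contractions; Chaykin–Jansson–Keil et al., JCTC 16 (2020) 4336, rounding of SDP certificates);
O. Bratteli, D. W. Robinson, *Operator Algebras and Quantum Statistical Mechanics 2*, Prop. 5.2.2 (`‖a(f)‖ = ‖f‖`: CAR
words are contractions); T. Helgaker, P. Jørgensen, J. Olsen, *Molecular Electronic-Structure Theory* (2000) eq. (2.2.18).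
-/

noncomputable section

namespace Summit.Ventures.CertifiedQuantumChemistry

open Matrix Finset
open Literature.MathematicalPhysics.QuantumLattice Literature.MathematicalPhysics.QuantumChemistry
open Literature.MathematicalPhysics.QuantumManyBody.StateRelaxation
open scoped ComplexOrder

/-! ## The term list of a model as ladder words -/

section Terms

variable {k : ℕ}

/-- **The raw term list as ladder words.** `H_F − E_core·1 = Σ_{(p,q,σ)} h_pq • a†_{pσ}a_{qσ} +
Σ_{(p,q,r,s,σ,τ)} ((pq|rs)/2) • a†_{pσ}a†_{rτ}a_{sτ}a_{qσ}`, each word a `ladderWord` (FORMAT-qcu0 §1 / FORMAT-qcmps0 §3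
`terms_from_integrals` over all index tuples; Helgaker–Jørgensen–Olsen (2.2.18)). -/
theorem Model.hamiltonian_sub_ecore_eq (F : Model k) :
    F.hamiltonian - (F.ecore : ℂ) • (1 : Op k) =
      ∑ t : Fin k × Fin k × Fin 2,
          ((F.h t.1 t.2.1 : ℚ) : ℂ) • ladderWord [(orb t.1 t.2.2, true), (orb t.2.1 t.2.2, false)] +
        ∑ t : Fin k × Fin k × Fin k × Fin k × Fin 2 × Fin 2,
          ((F.eri t.1 t.2.1 t.2.2.1 t.2.2.2.1 / 2 : ℚ) : ℂ) •
            ladderWord [(orb t.1 t.2.2.2.2.1, true), (orb t.2.2.1 t.2.2.2.2.2, true),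
              (orb t.2.2.2.1 t.2.2.2.2.2, false), (orb t.2.1 t.2.2.2.2.1, false)] := by
  have two : ∀ i j : Orb (Fin k), ladderWord [(i, true), (j, false)] = creation i * annihilation j :=
    fun i j => by simp [ladderWord_cons, ladderLetter]
  have four : ∀ i j l m : Orb (Fin k), ladderWord [(i, true), (j, true), (l, false), (m, false)] =
      creation i * creation j * annihilation l * annihilation m :=
    fun i j l m => by simp [ladderWord_cons, ladderLetter, Matrix.mul_assoc]
  unfold Model.hamiltonian molecularHamiltonian singletExcitation twoElectronExcitation
  rw [add_sub_cancel_right]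
  congr 1
  · simp only [Fintype.sum_prod_type, Finset.smul_sum, two]
  · simp only [Fintype.sum_prod_type, Finset.smul_sum, four, smul_smul]
    refine Finset.sum_congr rfl fun p _ => Finset.sum_congr rfl fun q _ =>
      Finset.sum_congr rfl fun r _ => Finset.sum_congr rfl fun s _ =>
      Finset.sum_congr rfl fun σ _ => Finset.sum_congr rfl fun τ _ => ?_
    congr 1
    push_cast
    ring

/-- **`Σ_t ‖c_t‖ = 2 Σ_{pq} |h_pq| + 2 Σ_{pqrs} |(pq|rs)|`**: the two spin labels of a one-body term and the four of a
two-body term (coefficient `(pq|rs)/2`) give the factors `2` and `4 · ½`. -/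
theorem Model.sum_norm_coeff_eq (F : Model k) :
    ∑ t : Fin k × Fin k × Fin 2, ‖((F.h t.1 t.2.1 : ℚ) : ℂ)‖ +
        ∑ t : Fin k × Fin k × Fin k × Fin k × Fin 2 × Fin 2, ‖((F.eri t.1 t.2.1 t.2.2.1 t.2.2.2.1 / 2 : ℚ) : ℂ)‖ =
      ((2 * ∑ p, ∑ q, |F.h p q| + 2 * ∑ p, ∑ q, ∑ r, ∑ s, |F.eri p q r s| : ℚ) : ℝ) := by
  have hn : ∀ q : ℚ, ‖(q : ℂ)‖ = ((|q| : ℚ) : ℝ) := fun q => by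
    rw [← Complex.ofReal_ratCast, Complex.norm_real, Real.norm_eq_abs, Rat.cast_abs]
  simp only [hn]
  rw [← Rat.cast_sum, ← Rat.cast_sum, ← Rat.cast_add]
  congr 1
  have h1 : ∀ x : ℚ, ∑ _σ : Fin 2, |x| = 2 * |x| := fun x => by
    rw [Finset.sum_const, Finset.card_univ, Fintype.card_fin, nsmul_eq_mul, Nat.cast_ofNat]
  have h2 : ∀ x : ℚ, ∑ _σ : Fin 2, 2 * |x / 2| = 2 * |x| := fun x => by
    rw [Finset.sum_const, Finset.card_univ, Fintype.card_fin, nsmul_eq_mul, Nat.cast_ofNat, abs_div, abs_two]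
    ring
  simp only [Fintype.sum_prod_type, h1, h2, Finset.mul_sum]

/-! ## The triangle lower certificate -/

/-- **THE TRIANGLE LOWER CERTIFICATE, for EVERY model and sector.** If `lo ≤ B_△(F) = E_core − 2Σ|h_pq| − 2Σ|(pq|rs)|`
then `LowerCertificate F a b lo` (`Rows/SectorRows.lean`): Gram part empty, no multipliers, `c = E_core`, residual
ladder words = the whole term list (cost `Σ_t ‖c_t‖`). No symmetry is needed for the predicate itself. -/
theorem Model.lowerCertificate_triangle (F : Model k) (a b : ℕ) {lo : ℚ}
    (hlo : lo ≤ F.ecore - 2 * ∑ p, ∑ q, |F.h p q| - 2 * ∑ p, ∑ q, ∑ r, ∑ s, |F.eri p q r s|) :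
    LowerCertificate F a b lo := by
  classical
  let T := (Fin k × Fin k × Fin 2) ⊕ (Fin k × Fin k × Fin k × Fin k × Fin 2 × Fin 2)
  let cT : T → ℂ := Sum.elim (fun t => ((F.h t.1 t.2.1 : ℚ) : ℂ))
    (fun t => ((F.eri t.1 t.2.1 t.2.2.1 t.2.2.2.1 / 2 : ℚ) : ℂ))
  let wT : T → List (Orb (Fin k) × Bool) := Sum.elim
    (fun t => [(orb t.1 t.2.2, true), (orb t.2.1 t.2.2, false)])
    (fun t => [(orb t.1 t.2.2.2.2.1, true), (orb t.2.2.1 t.2.2.2.2.2, true),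
      (orb t.2.2.2.1 t.2.2.2.2.2, false), (orb t.2.1 t.2.2.2.2.1, false)])
  let e : T ≃ Fin (Fintype.card T) := Fintype.equivFin T
  refine ⟨0, 0, 0, 0, 0, 0, Fintype.card T, 0, Matrix.PosSemidef.zero, fun _ => 0, fun j => j.elim0,
    fun j => j.elim0, fun j => j.elim0, fun j => j.elim0, fun j => j.elim0, fun j => j.elim0, fun j => j.elim0,
    fun j => j.elim0, fun j => j.elim0, fun j => j.elim0, fun j => cT (e.symm j), fun j => wT (e.symm j),
    (F.ecore : ℝ), ?_, ?_⟩
  · -- the inequality `lo ≤ c − Σ‖a_k‖`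
    rw [e.symm.sum_comp (fun t => ‖cT t‖), Fintype.sum_sum_type]
    simp only [cT, Sum.elim_inl, Sum.elim_inr]
    rw [Model.sum_norm_coeff_eq]
    have h : ((lo : ℚ) : ℝ) ≤
        ((F.ecore - 2 * ∑ p, ∑ q, |F.h p q| - 2 * ∑ p, ∑ q, ∑ r, ∑ s, |F.eri p q r s| : ℚ) : ℝ) := by
      exact_mod_cast hlo
    refine h.trans (le_of_eq ?_)
    push_cast
    ring
  · -- the operator identity
    simp only [Finset.univ_eq_empty, Finset.sum_empty, add_zero, zero_add, gramForm]
    rw [e.symm.sum_comp (fun t => cT t • ladderWord (wT t)), Fintype.sum_sum_type]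
    simp only [cT, wT, Sum.elim_inl, Sum.elim_inr]
    rw [Complex.ofReal_ratCast]
    exact F.hamiltonian_sub_ecore_eq

/-- **TRIANGLE LOWER ROW**: for a symmetric model and a sector in range, every `lo ≤ B_△(F)` is a certified lower row
`LowerRow F a b lo` — proved in the kernel, no claim node (soundness `lowerRow_of_certificate`). -/
theorem Model.lowerRow_triangle {F : Model k} (hF : F.IsSymmetric) {a b : ℕ} (ha : a ≤ k) (hb : b ≤ k) {lo : ℚ}
    (hlo : lo ≤ F.ecore - 2 * ∑ p, ∑ q, |F.h p q| - 2 * ∑ p, ∑ q, ∑ r, ∑ s, |F.eri p q r s|) :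
    LowerRow F a b lo :=
  lowerRow_of_certificate hF ha hb (F.lowerCertificate_triangle a b hlo)

/-- The triangle bound is also a SINGLET lower row (`LowerRow.singlet`: the singlet minimum is larger). -/
theorem Model.singletLowerRow_triangle {F : Model k} (hF : F.IsSymmetric) {n : ℕ} (hn : n ≤ k) {lo : ℚ}
    (hlo : lo ≤ F.ecore - 2 * ∑ p, ∑ q, |F.h p q| - 2 * ∑ p, ∑ q, ∑ r, ∑ s, |F.eri p q r s|) :
    SingletLowerRow F n lo :=
  (Model.lowerRow_triangle hF hn hn hlo).singlet hF

/-- `B_△(F) ≤ E₀(H_F; a, b)` on the physical range. -/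
theorem Model.triangle_le_energy {F : Model k} (hF : F.IsSymmetric) {a b : ℕ} (ha : a ≤ k) (hb : b ≤ k) :
    ((F.ecore - 2 * ∑ p, ∑ q, |F.h p q| - 2 * ∑ p, ∑ q, ∑ r, ∑ s, |F.eri p q r s| : ℚ) : ℝ) ≤ F.energy a b :=
  (Model.lowerRow_triangle hF ha hb le_rfl).le

/-! ## Sanity handles: every upper row lies above the triangle bound -/

/-- **Every UPPER row of a symmetric model lies above `B_△`** (a decidable necessary condition on the slot `hi` of
any upper claim node). -/
theorem Model.triangle_le_of_upperRow {F : Model k} (hF : F.IsSymmetric) {a b : ℕ} {hi : ℚ}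
    (hU : UpperRow F a b hi) :
    F.ecore - 2 * ∑ p, ∑ q, |F.h p q| - 2 * ∑ p, ∑ q, ∑ r, ∑ s, |F.eri p q r s| ≤ hi :=
  Bracket.lo_le_hi ⟨Model.lowerRow_triangle hF hU.range.1 hU.range.2 le_rfl, hU⟩

/-- No upper row below `B_△`. -/
theorem Model.not_upperRow_of_lt_triangle {F : Model k} (hF : F.IsSymmetric) {a b : ℕ} {hi : ℚ}
    (hlt : hi < F.ecore - 2 * ∑ p, ∑ q, |F.h p q| - 2 * ∑ p, ∑ q, ∑ r, ∑ s, |F.eri p q r s|) :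
    ¬ UpperRow F a b hi :=
  fun hU => absurd (Model.triangle_le_of_upperRow hF hU) (not_le.mpr hlt)

/-- **FALSIFICATION HANDLE**: an `UpperCertificate` claim with a value below `B_△` is refutable in the kernel. -/
theorem Model.not_upperCertificate_of_lt_triangle {F : Model k} (hF : F.IsSymmetric) {a b : ℕ} {hi : ℚ}
    (hlt : hi < F.ecore - 2 * ∑ p, ∑ q, |F.h p q| - 2 * ∑ p, ∑ q, ∑ r, ∑ s, |F.eri p q r s|) :
    ¬ UpperCertificate F a b hi :=
  fun h => Model.not_upperRow_of_lt_triangle hF hlt (upperRow_of_certificate hF h)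

/-! ## The singlet END form with the certificate's own `B_△` -/

/-- **SINGLET UPPER ROW FROM A SPIN-CONTAMINATED CERTIFICATE WITH ITS OWN `B_triangle` (FORMAT-qcmps0 §4b).** A
`SingletUpperCertificateSpin F n B hi` (`Rows/SingletUpperSpinBound.lean`) whose printed constant satisfies
`B ≤ B_△(F)` proves `SingletUpperRow F n hi` — no second claim node: the admissibility of `B` is this file's theorem
and `B ≤ B_△(F)` is decidable arithmetic on the model's rationals. -/
theorem singletUpperRow_of_spinCertificate_triangle {F : Model k} (hF : F.IsSymmetric) {n : ℕ} (hn : n ≤ k)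
    {B hi : ℚ} (hB : B ≤ F.ecore - 2 * ∑ p, ∑ q, |F.h p q| - 2 * ∑ p, ∑ q, ∑ r, ∑ s, |F.eri p q r s|)
    (h : SingletUpperCertificateSpin F n B hi) : SingletUpperRow F n hi :=
  singletUpperRow_of_spinCertificate hF (Model.lowerRow_triangle hF hn hn hB) h

end Terms

/-! ## One-pass kernel evaluation on `Model.ofTables` literals -/

section Tables

/-- `|z / n| = |z| / n` at the level of table entries. -/
theorem abs_entryVal (e : ℤ × ℕ) : |entryVal e| = entryVal ((e.1.natAbs : ℤ), e.2) := by
  obtain ⟨z, n⟩ := e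
  simp only [entryVal_eq_div, Int.natCast_natAbs, Int.cast_abs, abs_div, Nat.abs_cast]

/-- A defaulted look-up is dominated by the sum of ALL matching entries (the first hit is one of them; no hypothesis
on the keys). -/
theorem abs_lookup_getD_le_sum {K V : Type*} [BEq K] [LawfulBEq K] [DecidableEq K] (val : V → ℚ) (κ : K) :
    ∀ l : List (K × V),
      |((l.lookup κ).map val).getD 0| ≤ (l.map fun e => if κ = e.1 then |val e.2| else 0).sum
  | [] => by simp
  | (k', v) :: t => by
    have hnn : 0 ≤ (t.map fun e => if κ = e.1 then |val e.2| else 0).sum := by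
      refine List.sum_nonneg ?_
      intro x hx
      obtain ⟨e, -, rfl⟩ := List.mem_map.1 hx
      split_ifs
      · exact abs_nonneg _
      · exact le_rfl
    rw [List.lookup_cons, List.map_cons, List.sum_cons]
    by_cases h : κ = k'
    · subst h
      simp only [beq_self_eq_true, Option.map_some, Option.getD_some, if_true]
      exact le_add_of_nonneg_right hnn
    · have hb : (κ == k') = false := beq_eq_false_iff_ne.mpr h
      simp only [hb, if_neg h, zero_add]
      exact abs_lookup_getD_le_sum val κ t

/-- **Look-up sums are bounded by a weighted one-pass table sum**: if at most `N κ` indices share the key `κ`, then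
`Σ_x |table[key x]| ≤ Σ_{e ∈ table} N(key e) · |val e|` (no hypothesis on the table). -/
theorem sum_abs_lookup_getD_le {X K V : Type*} [Fintype X] [BEq K] [LawfulBEq K] [DecidableEq K]
    (key : X → K) (val : V → ℚ) (N : K → ℕ)
    (hN : ∀ κ, (Finset.univ.filter fun x => key x = κ).card ≤ N κ) (l : List (K × V)) :
    ∑ x, |((l.lookup (key x)).map val).getD 0| ≤ (l.map fun e => (N e.1 : ℚ) * |val e.2|).sum := by
  calc ∑ x, |((l.lookup (key x)).map val).getD 0|
      ≤ ∑ x, (l.map fun e => if key x = e.1 then |val e.2| else 0).sum :=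
        Finset.sum_le_sum fun x _ => abs_lookup_getD_le_sum val (key x) l
    _ = (l.map fun e => ∑ x, if key x = e.1 then |val e.2| else 0).sum :=
        Model.finset_sum_list_sum _ (fun x e => if key x = e.1 then |val e.2| else 0) l
    _ ≤ (l.map fun e => (N e.1 : ℚ) * |val e.2|).sum := List.sum_le_sum fun e _ => by
        rw [← Finset.sum_filter, Finset.sum_const, nsmul_eq_mul]
        exact mul_le_mul_of_nonneg_right (by exact_mod_cast hN e.1) (abs_nonneg _)

/-- **At most two ordered pairs share a sorted pair key, at most one if the key is diagonal.** -/
theorem card_filter_pairKey_le (k : ℕ) (κ : ℕ × ℕ) :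
    (Finset.univ.filter fun y : Fin k × Fin k => pairKey y.1.val y.2.val = κ).card ≤
      if κ.1 = κ.2 then 1 else 2 := by
  classical
  set G1 := Finset.univ.filter fun y : Fin k × Fin k => y.1.val = κ.1 ∧ y.2.val = κ.2 with hG1
  set G2 := Finset.univ.filter fun y : Fin k × Fin k => y.1.val = κ.2 ∧ y.2.val = κ.1 with hG2
  have h1 : G1.card ≤ 1 := Finset.card_le_one.2 fun a ha b hb => by
    simp only [hG1, Finset.mem_filter, Finset.mem_univ, true_and] at ha hb
    exact Prod.ext (Fin.ext (ha.1.trans hb.1.symm)) (Fin.ext (ha.2.trans hb.2.symm))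
  have h2 : G2.card ≤ 1 := Finset.card_le_one.2 fun a ha b hb => by
    simp only [hG2, Finset.mem_filter, Finset.mem_univ, true_and] at ha hb
    exact Prod.ext (Fin.ext (ha.1.trans hb.1.symm)) (Fin.ext (ha.2.trans hb.2.symm))
  have hsub : (Finset.univ.filter fun y : Fin k × Fin k => pairKey y.1.val y.2.val = κ) ⊆ G1 ∪ G2 := by
    intro y hy
    simp only [Finset.mem_filter, Finset.mem_univ, true_and, Finset.mem_union, hG1, hG2] at hy ⊢
    unfold pairKey at hy
    split_ifs at hy
    · exact Or.inl ⟨(Prod.ext_iff.1 hy).1, (Prod.ext_iff.1 hy).2⟩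
    · exact Or.inr ⟨(Prod.ext_iff.1 hy).2, (Prod.ext_iff.1 hy).1⟩
  split_ifs with hκ
  · have hsub' : (Finset.univ.filter fun y : Fin k × Fin k => pairKey y.1.val y.2.val = κ) ⊆ G1 := by
      intro y hy
      rcases Finset.mem_union.1 (hsub hy) with h | h
      · exact h
      · simp only [hG1, hG2, Finset.mem_filter, Finset.mem_univ, true_and] at h ⊢
        exact ⟨h.1.trans hκ.symm, h.2.trans hκ⟩
    exact (Finset.card_le_card hsub').trans h1
  · exact (Finset.card_le_card hsub).trans ((Finset.card_union_le _ _).trans (add_le_add h1 h2))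

/-- **At most `m₄(κ) = [P₁ = P₂ ? 1 : 2]·m₂(P₁)·m₂(P₂)` index quadruples share a canonical key `κ = (P₁, P₂)`**
(the 8-fold orbit of real two-electron integrals, counted with its stabiliser). -/
theorem card_filter_quadKey_le (k : ℕ) (κ : (ℕ × ℕ) × (ℕ × ℕ)) :
    (Finset.univ.filter fun x : (Fin k × Fin k) × (Fin k × Fin k) =>
        quadKey x.1.1.val x.1.2.val x.2.1.val x.2.2.val = κ).card ≤
      (if κ.1 = κ.2 then 1 else 2) * ((if κ.1.1 = κ.1.2 then 1 else 2) * (if κ.2.1 = κ.2.2 then 1 else 2)) := by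
  classical
  set F : ℕ × ℕ → Finset (Fin k × Fin k) := fun P =>
    Finset.univ.filter fun y : Fin k × Fin k => pairKey y.1.val y.2.val = P with hFdef
  have hF : ∀ P : ℕ × ℕ, (F P).card ≤ if P.1 = P.2 then 1 else 2 := fun P => card_filter_pairKey_le k P
  have hsub : (Finset.univ.filter fun x : (Fin k × Fin k) × (Fin k × Fin k) =>
      quadKey x.1.1.val x.1.2.val x.2.1.val x.2.2.val = κ) ⊆ (F κ.1 ×ˢ F κ.2) ∪ (F κ.2 ×ˢ F κ.1) := by
    intro x hx
    simp only [Finset.mem_filter, Finset.mem_univ, true_and, Finset.mem_union, Finset.mem_product, hFdef] at hx ⊢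
    unfold quadKey at hx
    split_ifs at hx
    · exact Or.inl ⟨(Prod.ext_iff.1 hx).1, (Prod.ext_iff.1 hx).2⟩
    · exact Or.inr ⟨(Prod.ext_iff.1 hx).2, (Prod.ext_iff.1 hx).1⟩
  by_cases hκ : κ.1 = κ.2
  · rw [if_pos hκ, one_mul]
    have hsub' : (Finset.univ.filter fun x : (Fin k × Fin k) × (Fin k × Fin k) =>
        quadKey x.1.1.val x.1.2.val x.2.1.val x.2.2.val = κ) ⊆ F κ.1 ×ˢ F κ.2 := by
      intro x hx
      rcases Finset.mem_union.1 (hsub hx) with h | h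
      · exact h
      · rw [Finset.mem_product] at h ⊢
        rw [hκ] at h ⊢
        exact ⟨hκ ▸ h.1, h.2⟩
    calc _ ≤ (F κ.1 ×ˢ F κ.2).card := Finset.card_le_card hsub'
      _ = (F κ.1).card * (F κ.2).card := Finset.card_product _ _
      _ ≤ _ := Nat.mul_le_mul (hF _) (hF _)
  · rw [if_neg hκ]
    calc _ ≤ ((F κ.1 ×ˢ F κ.2) ∪ (F κ.2 ×ˢ F κ.1)).card := Finset.card_le_card hsub
      _ ≤ (F κ.1 ×ˢ F κ.2).card + (F κ.2 ×ˢ F κ.1).card := Finset.card_union_le _ _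
      _ = (F κ.1).card * (F κ.2).card + (F κ.2).card * (F κ.1).card := by
          rw [Finset.card_product, Finset.card_product]
      _ ≤ (if κ.1.1 = κ.1.2 then 1 else 2) * (if κ.2.1 = κ.2.2 then 1 else 2) +
            (if κ.2.1 = κ.2.2 then 1 else 2) * (if κ.1.1 = κ.1.2 then 1 else 2) :=
          add_le_add (Nat.mul_le_mul (hF _) (hF _)) (Nat.mul_le_mul (hF _) (hF _))
      _ = _ := by ring

/-- **One-body coefficient sum of a literal model, one pass over `hT`:** `Σ_{pq} |h_pq| ≤ Σ_{e ∈ hT} m₂(key e)·|val e|`. -/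
theorem Model.sum_abs_h_ofTables_le (k : ℕ) (hT : List ((ℕ × ℕ) × (ℤ × ℕ)))
    (eT : List (((ℕ × ℕ) × (ℕ × ℕ)) × (ℤ × ℕ))) (ecore : ℚ) :
    ∑ p, ∑ q, |(Model.ofTables k hT eT ecore).h p q| ≤
      Model.sumAcc (fun e => (if e.1.1 = e.1.2 then (1 : ℚ) else 2) * entryVal ((e.2.1.natAbs : ℤ), e.2.2)) hT 0 := by
  classical
  rw [Model.sumAcc_eq, zero_add]
  have h := sum_abs_lookup_getD_le (fun y : Fin k × Fin k => pairKey y.1.val y.2.val) entryVal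
    (fun κ => if κ.1 = κ.2 then 1 else 2) (card_filter_pairKey_le k) hT
  rw [Fintype.sum_prod_type] at h
  refine (le_of_eq rfl).trans (h.trans (le_of_eq (congrArg List.sum (List.map_congr_left fun e _ => ?_))))
  rw [abs_entryVal]
  push_cast
  rfl

/-- **Two-body coefficient sum of a literal model, one pass over `eT`:**
`Σ_{pqrs} |(pq|rs)| ≤ Σ_{e ∈ eT} m₄(key e)·|val e|`. -/
theorem Model.sum_abs_eri_ofTables_le (k : ℕ) (hT : List ((ℕ × ℕ) × (ℤ × ℕ)))
    (eT : List (((ℕ × ℕ) × (ℕ × ℕ)) × (ℤ × ℕ))) (ecore : ℚ) :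
    ∑ p, ∑ q, ∑ r, ∑ s, |(Model.ofTables k hT eT ecore).eri p q r s| ≤
      Model.sumAcc (fun e => (if e.1.1 = e.1.2 then (1 : ℚ) else 2) *
        ((if e.1.1.1 = e.1.1.2 then (1 : ℚ) else 2) * (if e.1.2.1 = e.1.2.2 then (1 : ℚ) else 2)) *
        entryVal ((e.2.1.natAbs : ℤ), e.2.2)) eT 0 := by
  classical
  rw [Model.sumAcc_eq, zero_add]
  have h := sum_abs_lookup_getD_le
    (fun x : (Fin k × Fin k) × (Fin k × Fin k) => quadKey x.1.1.val x.1.2.val x.2.1.val x.2.2.val) entryVal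
    (fun κ => (if κ.1 = κ.2 then 1 else 2) * ((if κ.1.1 = κ.1.2 then 1 else 2) * (if κ.2.1 = κ.2.2 then 1 else 2)))
    (card_filter_quadKey_le k) eT
  simp only [Fintype.sum_prod_type] at h
  refine (le_of_eq rfl).trans (h.trans (le_of_eq (congrArg List.sum (List.map_congr_left fun e _ => ?_))))
  rw [abs_entryVal]
  push_cast
  rfl

/-- **KERNEL ENTRY POINT — the triangle lower row of a literal model.** For `Model.ofTables k hT eT ecore` and a
sector in range, `LowerRow … a b lo` follows from the single numeric hypothesis
`lo ≤ ecore − 2·fold₂(hT) − 2·fold₄(eT)` (one accumulator pass per table, `decide +kernel` on tree literals). -/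
theorem Model.lowerRow_ofTables_triangle (k : ℕ) (hT : List ((ℕ × ℕ) × (ℤ × ℕ)))
    (eT : List (((ℕ × ℕ) × (ℕ × ℕ)) × (ℤ × ℕ))) (ecore : ℚ) {a b : ℕ} (ha : a ≤ k) (hb : b ≤ k) {lo : ℚ}
    (hlo : lo ≤ ecore
      - 2 * Model.sumAcc (fun e => (if e.1.1 = e.1.2 then (1 : ℚ) else 2) *
          entryVal ((e.2.1.natAbs : ℤ), e.2.2)) hT 0
      - 2 * Model.sumAcc (fun e => (if e.1.1 = e.1.2 then (1 : ℚ) else 2) *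
          ((if e.1.1.1 = e.1.1.2 then (1 : ℚ) else 2) * (if e.1.2.1 = e.1.2.2 then (1 : ℚ) else 2)) *
          entryVal ((e.2.1.natAbs : ℤ), e.2.2)) eT 0) :
    LowerRow (Model.ofTables k hT eT ecore) a b lo := by
  have h1 := Model.sum_abs_h_ofTables_le k hT eT ecore
  have h2 := Model.sum_abs_eri_ofTables_le k hT eT ecore
  have h3 : (Model.ofTables k hT eT ecore).ecore = ecore := rfl
  refine Model.lowerRow_triangle (Model.ofTables_isSymmetric k hT eT ecore) ha hb ?_
  rw [h3]
  linarith

end Tables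

end Summit.Ventures.CertifiedQuantumChemistry

end
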